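import Literature.Topology.FourManifolds.MTorusPoints
import Literature.Topology.FourManifolds.GompfTubeStraightening
import Literature.Topology.FourManifolds.CircleSurgeryExistence
import HarnessLib

/-!
# Points of the product-surgered sphere: off the section circle and in the new piece

The straightened Cappell–Shaneson model `modelSphere` (`GompfShearModel.lean`) is the surgery
`prodSurgered ψ ε …` on the section circle of the mapping torus `X_ψ` along the product tube
(`GompfFramedTwistTransport.lean`). The embedding of the fishtail end model into it (the model
version of R. Gompf, *More Cappell–Shaneson spheres are standard*, Algebr. Geom. Topol. 10 (2010),
Lemma 2.2) is written with two constructors, provided here with their calculus: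

* `Literature.Topology.FourManifolds.sphIn ψ ε … x s` — the point `[x, s]` of `X_ψ` (`mtPt`,
  `MTorusPoints.lean`) seen in the surgered manifold, for `x ≠ 1` (off the section circle,
  `mtPt_mem_range_secCircle_iff`) and `s ∈ (0, 3/2)`; smoothness `contMDiffAt_sphIn_comp`;
  injectivity from that of `mtPt`.
* `Literature.Topology.FourManifolds.sphCap ψ ε … w v` — the point `(w, v)` of the new piece
  `D̊² × 𝕊²`, `‖w‖ < 1`; smoothness `contMDiffAt_sphCap_comp`; injectivity.
* **The surgery relation in these terms** (`sphCap_smul_eq_sphIn`, `sphCap_smul_eq_sphIn_B`):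
  `sphCap (t u) v = sphIn (expT (shrink (t v))) (angA u)` for `0 < t < 1`, where
  `shrink w = ε (1 + |w|²)^{-1/2} w` (`shrink_const_apply`) — the identification of the punctured
  tube with the punctured disc bundle by the *same* radial parameter (`circleSurgeryRel`).
* the vector utilities `Literature.Topology.FourManifolds.e2OfC : ℂ → ℝ²` (inverse of the tree's
  `toC`) and `Literature.Topology.FourManifolds.vec3`, and the **vertical family**
  `Literature.Topology.FourManifolds.fishVert` (a circle in the `(y, ℓ)`-fibre over a base point,
  the shell of a tubular neighbourhood of a graph) with the **cone**
  `Literature.Topology.FourManifolds.fishCone` in the new piece and their overlap identity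
  `conePt_eq_vertPt` (the cone read off the core sphere is a vertical circle).

Everything is proved; no named facts.

## References

* R. E. Gompf, *More Cappell–Shaneson spheres are standard*, Algebr. Geom. Topol. 10 (2010)
  1665–1681, Lemma 2.2 (proof) and §2 ¶1. [GompfAGT2010]
-/

noncomputable section

open scoped Manifold ContDiff Topology Real
open Set Function Filter Metric

namespace Literature.Topology.FourManifolds

local notation "𝔼" n => EuclideanSpace ℝ (Fin n)
local notation "𝕊 " n:arg => (Metric.sphere (0 : EuclideanSpace ℝ (Fin (n + 1))) 1)
local notation "𝓣" =>
  (ModelWithCorners.prod (𝓡 1) (ModelWithCorners.prod (𝓡 1) (𝓡 1)))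

attribute [local instance] fact_finrank_euclideanSpace_succ

/-! ### Vector utilities -/

section Vec

/-- `ℂ → ℝ²`, inverse of the tree's `toC`. [folklore] -/
def e2OfC (z : ℂ) : 𝔼 2 := (EuclideanSpace.equiv (Fin 2) ℝ).symm ![z.re, z.im]

/-- Components of `e2OfC`. [folklore] -/
@[simp] theorem e2OfC_apply_zero (z : ℂ) : e2OfC z 0 = z.re := rfl

/-- Components of `e2OfC`. [folklore] -/
@[simp] theorem e2OfC_apply_one (z : ℂ) : e2OfC z 1 = z.im := rfl

/-- `toC ∘ e2OfC = id`. [folklore] -/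
@[simp] theorem toC_e2OfC (z : ℂ) : toC (e2OfC z) = z := Complex.ext rfl rfl

/-- `e2OfC ∘ toC = id`. [folklore] -/
@[simp] theorem e2OfC_toC (v : 𝔼 2) : e2OfC (toC v) = v := by
  ext i; fin_cases i <;> rfl

/-- `e2OfC` preserves norms. [folklore] -/
@[simp] theorem norm_e2OfC (z : ℂ) : ‖e2OfC z‖ = ‖z‖ := by
  rw [← norm_toC (e2OfC z), toC_e2OfC]

/-- `e2OfC` is additive-linear: `e2OfC (a • z) = a • e2OfC z` for real `a`. [folklore] -/
theorem e2OfC_smul (a : ℝ) (z : ℂ) : e2OfC ((a : ℂ) * z) = a • e2OfC z := by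
  ext i; fin_cases i <;> simp [e2OfC]

/-- `e2OfC` is smooth (linear). [folklore] -/
theorem contDiff_e2OfC : ContDiff ℝ ∞ e2OfC := by
  have h : ContDiff ℝ ∞ fun z : ℂ ↦ (![z.re, z.im] : Fin 2 → ℝ) :=
    contDiff_pi.2 fun i ↦ by fin_cases i <;> [exact Complex.reCLM.contDiff; exact Complex.imCLM.contDiff]
  exact (EuclideanSpace.equiv (Fin 2) ℝ).symm.contDiff.comp h

/-- `e2OfC` of a point of the unit circle of `ℂ`: `e2OfC (e^{2πiθ}) = circlePt θ`. [folklore] -/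
theorem e2OfC_circleExp (θ : ℝ) : e2OfC (Circle.exp (2 * π * θ)) = (circlePt θ : 𝔼 2) := by
  rw [← toC_circlePt, e2OfC_toC]

/-- The norm of `vec3`. [folklore] -/
theorem norm_vec3 (a b c : ℝ) : ‖vec3 a b c‖ = Real.sqrt (a ^ 2 + b ^ 2 + c ^ 2) := by
  rw [EuclideanSpace.norm_eq, Fin.sum_univ_three]
  simp [vec3, sq_abs]

/-- `vec3` is smooth in its three entries (jointly, as a map `ℝ × ℝ × ℝ → ℝ³`). [folklore] -/
theorem contDiff_vec3 : ContDiff ℝ ∞ fun p : ℝ × ℝ × ℝ ↦ vec3 p.1 p.2.1 p.2.2 := by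
  have h : ContDiff ℝ ∞ fun p : ℝ × ℝ × ℝ ↦ (![p.1, p.2.1, p.2.2] : Fin 3 → ℝ) :=
    contDiff_pi.2 fun i ↦ by
      fin_cases i
      · exact contDiff_fst
      · exact contDiff_fst.comp contDiff_snd
      · exact contDiff_snd.comp contDiff_snd
  exact (EuclideanSpace.equiv (Fin 3) ℝ).symm.contDiff.comp h

/-- Scaling `vec3`. [folklore] -/
theorem smul_vec3 (t a b c : ℝ) : t • vec3 a b c = vec3 (t * a) (t * b) (t * c) := by
  ext i; fin_cases i <;> simp [vec3]


end Vec

/-! ### The shrinking map of the constant tube -/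

section Shrink

/-- **The shrinking map of the constant tube datum**: `shrink w = ε (1 + |w|²)^{-1/2} w`
(Mathlib's `univBall 0 ε`). [folklore] -/
theorem shrink_const_apply {ε : ℝ} (hε : 0 < ε) (hεπ : ε ≤ π) (w : 𝔼 3) :
    (TubeTwist.const ε hε hεπ).shrink w = ε • ((Real.sqrt (1 + ‖w‖ ^ 2))⁻¹ • w) := by
  rw [TubeTwist.shrink, show (TubeTwist.const ε hε hεπ).ε = ε from rfl, OpenPartialHomeomorph.univBall,
    dif_pos hε]
  simp [OpenPartialHomeomorph.univUnitBall_apply, OpenPartialHomeomorph.unitBallBall_apply]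

/-- The norm of the shrunk vector: `|shrink w| = ε |w| / √(1 + |w|²)`. [folklore] -/
theorem norm_shrink_const {ε : ℝ} (hε : 0 < ε) (hεπ : ε ≤ π) (w : 𝔼 3) :
    ‖(TubeTwist.const ε hε hεπ).shrink w‖ = ε * ‖w‖ / Real.sqrt (1 + ‖w‖ ^ 2) := by
  have h : 0 < Real.sqrt (1 + ‖w‖ ^ 2) := Real.sqrt_pos.2 (by positivity)
  rw [shrink_const_apply hε hεπ, norm_smul, norm_smul, Real.norm_eq_abs, abs_of_pos hε, Real.norm_eq_abs,
    abs_of_pos (inv_pos.2 h)]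
  field_simp

/-- **A nonzero vector of norm `< π` is not sent to `1` by `expT`** (each coordinate lies in
`(-π, π)`, where `expT` is injective). [folklore] -/
theorem expT_ne_one_of_norm_lt {v : 𝔼 3} (hv : v ≠ 0) (h : ‖v‖ < π) : expT v ≠ 1 := by
  intro h1
  apply hv
  have hcoord : ∀ (w : 𝔼 3) (j : Fin 3), |w j| ≤ ‖w‖ := fun w j ↦ by
    rw [EuclideanSpace.norm_eq, ← Real.sqrt_sq (abs_nonneg (w j))]
    refine Real.sqrt_le_sqrt ?_
    rw [Fin.sum_univ_three]
    fin_cases j <;> simp [sq_abs] <;> nlinarith [sq_nonneg (w 0), sq_nonneg (w 1), sq_nonneg (w 2)]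
  have hmem : ∀ w : 𝔼 3, ‖w‖ < π → w ∈ {v : 𝔼 3 | ∀ j, v j ∈ Ioc (-π) π} := fun w hw j ↦ by
    have := (hcoord w j).trans_lt hw
    exact ⟨by linarith [neg_abs_le (w j)], by linarith [le_abs_self (w j)]⟩
  refine expT_injOn (hmem v h) (hmem 0 (by rw [norm_zero]; exact Real.pi_pos)) ?_
  rw [h1, expT_zero]

/-- The shrunk vector of a nonzero vector is nonzero and of norm `< ε ≤ π`; hence `expT` of it is
not `1`. [folklore] -/
theorem expT_shrink_ne_one {ε : ℝ} (hε : 0 < ε) (hεπ : ε ≤ π) {w : 𝔼 3} (hw : w ≠ 0) :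
    expT ((TubeTwist.const ε hε hεπ).shrink w) ≠ 1 := by
  refine expT_ne_one_of_norm_lt ?_ ((TubeTwist.norm_shrink_const_lt hε hεπ w).trans_le hεπ)
  rw [shrink_const_apply hε hεπ]
  have h : 0 < Real.sqrt (1 + ‖w‖ ^ 2) := Real.sqrt_pos.2 (by positivity)
  exact smul_ne_zero hε.ne' (smul_ne_zero (inv_ne_zero h.ne') hw)

end Shrink

/-! ### Points of the product-surgered sphere -/

section Sphere

/-- The monodromy fixes `1 = expT 0`. [folklore] -/
theorem apply_one_eq_one {ψ : ThreeTorus ≃ₘ⟮𝓣, 𝓣⟯ ThreeTorus} {ε : ℝ} (hε : 0 < ε)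
    (hψ : ∀ v : 𝔼 3, ‖v‖ < ε → ψ (expT v) = expT v) : ψ 1 = 1 := by
  have h := hψ 0 (by rw [norm_zero]; exact hε)
  rwa [expT_zero] at h

variable (ψ : ThreeTorus ≃ₘ⟮𝓣, 𝓣⟯ ThreeTorus) (ε : ℝ) (hε : 0 < ε) (hεπ : ε ≤ π)
  (hψ : ∀ v : 𝔼 3, ‖v‖ < ε → ψ (expT v) = expT v)

/-- A fixed fibre point off `1`: `(e^{iπ}, 1, 1) = (-1, 1, 1)`. [folklore] -/
def offOne : ThreeTorus := (Circle.exp π, 1, 1)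

/-- `offOne ≠ 1`. [folklore] -/
theorem offOne_ne_one : offOne ≠ 1 := by
  intro h
  have h1 : (Circle.exp π : ℂ) = 1 := by
    have := congrArg (fun z : ThreeTorus ↦ ((z.1 : Circle) : ℂ)) h
    simpa [offOne] using this
  rw [Circle.coe_exp, Complex.exp_pi_mul_I] at h1
  norm_num at h1

open Classical in
/-- **A point `[x, s]` off the section circle, as a point of the complement** (junk off the
domain `x ≠ 1`, `0 < s < 3/2`). [folklore] -/
def sphInSub (x : ThreeTorus) (s : ℝ) : ↥(prodTube ψ ε hε hεπ hψ).complement :=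
  if h : x ≠ 1 ∧ 0 < s ∧ s < 3 / 2 then
    ⟨mtPt ψ x s, by
      rw [CircleNbhd.mem_complement_iff,
        mtPt_mem_range_secCircle_iff (prodPair ψ ε hε hεπ hψ) (apply_one_eq_one hε hψ) h.2.1 h.2.2]
      exact h.1⟩
  else
    ⟨mtPt ψ offOne (3 / 4), by
      rw [CircleNbhd.mem_complement_iff, mtPt_mem_range_secCircle_iff (prodPair ψ ε hε hεπ hψ)
        (apply_one_eq_one hε hψ) (by norm_num) (by norm_num)]
      exact offOne_ne_one⟩

/-- **The point `[x, s]` of the surgered sphere** (off the section circle). [cite: GompfAGT2010, §2 (X_φ and the surgery on C)] -/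
def sphIn (x : ThreeTorus) (s : ℝ) : prodSurgered ψ ε hε hεπ hψ :=
  (prodTube ψ ε hε hεπ hψ).glueData.inl (sphInSub ψ ε hε hεπ hψ x s)

variable {ψ ε hε hεπ hψ}

/-- The underlying mapping-torus point. [folklore] -/
theorem coe_sphInSub {x : ThreeTorus} {s : ℝ} (hx : x ≠ 1) (hs0 : 0 < s) (hs1 : s < 3 / 2) :
    (sphInSub ψ ε hε hεπ hψ x s : MTorus ψ) = mtPt ψ x s := by
  rw [sphInSub, dif_pos ⟨hx, hs0, hs1⟩]

/-- **Injectivity of `sphIn` in the second cylinder** (`s, s' ∈ (1/2, 3/2)`, `x, x' ≠ 1`). [folklore] -/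
theorem sphIn_inj_two {x x' : ThreeTorus} {s s' : ℝ} (hx : x ≠ 1) (hx' : x' ≠ 1)
    (hs : 1 / 2 < s ∧ s < 3 / 2) (hs' : 1 / 2 < s' ∧ s' < 3 / 2)
    (h : sphIn ψ ε hε hεπ hψ x s = sphIn ψ ε hε hεπ hψ x' s') : x = x' ∧ s = s' := by
  have h1 := congrArg Subtype.val ((prodTube ψ ε hε hεπ hψ).glueData.inl_injective h)
  rw [coe_sphInSub hx (by linarith [hs.1]) hs.2, coe_sphInSub hx' (by linarith [hs'.1]) hs'.2] at h1
  exact mtPt_inj_two hs hs' h1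

/-- **Injectivity of `sphIn` in the first cylinder** (`s, s' ∈ (0, 1)`, `x, x' ≠ 1`). [folklore] -/
theorem sphIn_inj_one {x x' : ThreeTorus} {s s' : ℝ} (hx : x ≠ 1) (hx' : x' ≠ 1)
    (hs : 0 < s ∧ s < 1) (hs' : 0 < s' ∧ s' < 1)
    (h : sphIn ψ ε hε hεπ hψ x s = sphIn ψ ε hε hεπ hψ x' s') : x = x' ∧ s = s' := by
  have h1 := congrArg Subtype.val ((prodTube ψ ε hε hεπ hψ).glueData.inl_injective h)
  rw [coe_sphInSub hx hs.1 (by linarith [hs.2]), coe_sphInSub hx' hs'.1 (by linarith [hs'.2])] at h1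
  exact mtPt_inj_one hs hs' h1

/-- The general identification for `sphIn`: `s ∈ (0, 1)`, `s' ∈ (1/2, 3/2)`. [folklore] -/
theorem sphIn_eq_sphIn_iff {x x' : ThreeTorus} {s s' : ℝ} (hx : x ≠ 1) (hx' : x' ≠ 1)
    (hs : 0 < s ∧ s < 1) (hs' : 1 / 2 < s' ∧ s' < 3 / 2) :
    sphIn ψ ε hε hεπ hψ x s = sphIn ψ ε hε hεπ hψ x' s' ↔ (s' = s ∧ x' = x) ∨ (s' = s + 1 ∧ x' = ψ x) := by
  rw [sphIn, sphIn, ((prodTube ψ ε hε hεπ hψ).glueData.inl_injective).eq_iff, ← Subtype.coe_inj,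
    coe_sphInSub hx hs.1 (by linarith [hs.2]), coe_sphInSub hx' (by linarith [hs'.1]) hs'.2]
  exact mtPt_eq_mtPt_iff hs hs'

/-- The monodromy relation for `sphIn`: `sphIn (ψ x) (s + 1) = sphIn x s`, `s ∈ (0, 1/2)`. [folklore] -/
theorem sphIn_apply_add_one {x : ThreeTorus} (hx : x ≠ 1) {s : ℝ} (hs : 0 < s ∧ s < 1 / 2) :
    sphIn ψ ε hε hεπ hψ (ψ x) (s + 1) = sphIn ψ ε hε hεπ hψ x s := by
  have hx' : ψ x ≠ 1 := by
    intro h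
    apply hx
    apply ψ.injective
    show ψ x = ψ 1
    rw [h, apply_one_eq_one hε hψ]
  rw [sphIn, sphIn]
  congr 1
  apply Subtype.ext
  rw [coe_sphInSub hx' (by linarith [hs.1]) (by linarith [hs.2]), coe_sphInSub hx hs.1 (by linarith [hs.2])]
  exact mtPt_apply_add_one x hs

section SmoothIn

variable {EQ HQ : Type*} [NormedAddCommGroup EQ] [NormedSpace ℝ EQ] [TopologicalSpace HQ]
  {IQ : ModelWithCorners ℝ EQ HQ} {Q : Type*} [TopologicalSpace Q] [ChartedSpace HQ Q]

/-- **Smoothness of `q ↦ sphIn (F q) (G q)`** where `F`, `G` are smooth, `F q ≠ 1` and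
`G q ∈ (0, 3/2)`. [folklore] -/
theorem contMDiffAt_sphIn_comp {F : Q → ThreeTorus} {G : Q → ℝ} {q : Q} (hF : ContMDiffAt IQ 𝓣 ∞ F q)
    (hG : ContMDiffAt IQ 𝓘(ℝ, ℝ) ∞ G q) (hx : F q ≠ 1) (h0 : 0 < G q) (h1 : G q < 3 / 2) :
    ContMDiffAt IQ 𝓘(ℝ, 𝔼 4) ∞ (fun q ↦ sphIn ψ ε hε hεπ hψ (F q) (G q)) q := by
  refine (prodTube ψ ε hε hεπ hψ).glueData.contMDiff_inl.contMDiffAt.comp q ?_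
  rw [← ContMDiffAt.subtypeVal_comp_iff]
  have hev : ∀ᶠ q' in 𝓝 q, F q' ≠ 1 ∧ 0 < G q' ∧ G q' < 3 / 2 := by
    have h1' : ∀ᶠ q' in 𝓝 q, F q' ≠ 1 := hF.continuousAt.eventually (isOpen_ne.mem_nhds hx)
    have h2' : ∀ᶠ q' in 𝓝 q, G q' ∈ Ioo (0 : ℝ) (3 / 2) :=
      hG.continuousAt.eventually (isOpen_Ioo.mem_nhds ⟨h0, h1⟩)
    filter_upwards [h1', h2'] with q' a b using ⟨a, b.1, b.2⟩
  have hev' : (Subtype.val ∘ fun q' ↦ sphInSub ψ ε hε hεπ hψ (F q') (G q')) =ᶠ[𝓝 q]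
      fun q' ↦ mtPt ψ (F q') (G q') := by
    filter_upwards [hev] with q' hq'
    exact coe_sphInSub hq'.1 hq'.2.1 hq'.2.2
  exact (contMDiffAt_mtPt_comp hF hG h0 h1).congr_of_eventuallyEq hev'

end SmoothIn

/-! #### The new piece -/

variable (ψ ε hε hεπ hψ)

/-- A fixed point of the core sphere: `e₀`. [folklore] -/
def sphBase : 𝕊 2 := ⟨EuclideanSpace.single 0 1, by simp⟩

open Classical in
/-- **A point of the new piece as an element of `D̊² × 𝕊²`** (junk for `‖w‖ ≥ 1`). [folklore] -/
def sphCapSub (w : 𝔼 2) (v : 𝕊 2) : ↥discTimesSphere :=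
  if h : ‖w‖ < 1 then ⟨(w, v), h⟩ else ⟨(0, v), by simp⟩

/-- **The point `(w, v)` of the new piece of the surgered sphere** (`‖w‖ < 1`). [cite: GompfAGT2010, §2 (surgery on C yields Σ_A)] -/
def sphCap (w : 𝔼 2) (v : 𝕊 2) : prodSurgered ψ ε hε hεπ hψ :=
  (prodTube ψ ε hε hεπ hψ).glueData.inr (sphCapSub w v)

variable {ψ ε hε hεπ hψ}

/-- The underlying point. [folklore] -/
theorem coe_sphCapSub {w : 𝔼 2} (hw : ‖w‖ < 1) (v : 𝕊 2) :
    (sphCapSub w v : (𝔼 2) × (𝕊 2)) = (w, v) := by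
  rw [sphCapSub, dif_pos hw]

/-- **Injectivity of `sphCap`** on `‖w‖, ‖w'‖ < 1`. [folklore] -/
theorem sphCap_inj {w w' : 𝔼 2} {v v' : 𝕊 2} (hw : ‖w‖ < 1) (hw' : ‖w'‖ < 1)
    (h : sphCap ψ ε hε hεπ hψ w v = sphCap ψ ε hε hεπ hψ w' v') : w = w' ∧ v = v' := by
  have h1 := congrArg Subtype.val ((prodTube ψ ε hε hεπ hψ).glueData.inr_injective h)
  rw [coe_sphCapSub hw, coe_sphCapSub hw'] at h1
  exact Prod.ext_iff.1 h1

section SmoothCap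

variable {EQ HQ : Type*} [NormedAddCommGroup EQ] [NormedSpace ℝ EQ] [TopologicalSpace HQ]
  {IQ : ModelWithCorners ℝ EQ HQ} {Q : Type*} [TopologicalSpace Q] [ChartedSpace HQ Q]

/-- **Smoothness of `q ↦ sphCap (W q) (V q)`** where `W`, `V` are smooth and `‖W q‖ < 1`. [folklore] -/
theorem contMDiffAt_sphCap_comp {W : Q → 𝔼 2} {V : Q → 𝕊 2} {q : Q}
    (hW : ContMDiffAt IQ 𝓘(ℝ, 𝔼 2) ∞ W q) (hV : ContMDiffAt IQ (𝓡 2) ∞ V q) (hw : ‖W q‖ < 1) :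
    ContMDiffAt IQ 𝓘(ℝ, 𝔼 4) ∞ (fun q ↦ sphCap ψ ε hε hεπ hψ (W q) (V q)) q := by
  refine (prodTube ψ ε hε hεπ hψ).glueData.contMDiff_inr.contMDiffAt.comp q ?_
  rw [← ContMDiffAt.subtypeVal_comp_iff]
  have hev : ∀ᶠ q' in 𝓝 q, ‖W q'‖ < 1 :=
    hW.continuousAt.eventually ((isOpen_lt continuous_norm continuous_const).mem_nhds hw)
  have hev' : (Subtype.val ∘ fun q' ↦ sphCapSub (W q') (V q')) =ᶠ[𝓝 q] fun q' ↦ (W q', V q') := by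
    filter_upwards [hev] with q' hq'
    exact coe_sphCapSub hq' _
  exact (hW.prodMk hV).congr_of_eventuallyEq hev'

end SmoothCap

/-! #### The surgery relation -/

/-- **The surgery relation**: for `u ∈ 𝕊¹` off `ptA`, `0 < t < 1` and `v ∈ 𝕊²`, the point
`(t u, v)` of the new piece is the point `[expT (shrink (t v)), angA u]` of the old one — the two
pieces are identified by the same radial parameter `t`. [cite: GompfAGT2010, §2 (surgery on C); cf. Gompf–Stipsicz §5.2] -/
theorem sphCap_smul_eq_sphIn {u : 𝕊 1} (hu : u ≠ ptA) {t : ℝ} (ht : t ∈ Ioo (0 : ℝ) 1) (v : 𝕊 2) :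
    sphCap ψ ε hε hεπ hψ (t • (u : 𝔼 2)) v =
      sphIn ψ ε hε hεπ hψ (expT ((TubeTwist.const ε hε hεπ).shrink (t • (v : 𝔼 3)))) (angA u) := by
  have htv : t • (v : 𝔼 3) ≠ 0 := smul_ne_zero ht.1.ne' (ne_zero_of_mem_unit_sphere v)
  have hx : expT ((TubeTwist.const ε hε hεπ).shrink (t • (v : 𝔼 3))) ≠ 1 := expT_shrink_ne_one hε hεπ htv
  have ha : 0 < angA u ∧ angA u < 1 := ⟨(angA_mem_Ioc u).1, angA_lt_one hu⟩
  have hw : ‖t • (u : 𝔼 2)‖ < 1 := by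
    rw [norm_smul, Real.norm_eq_abs, abs_of_pos ht.1, norm_eq_of_mem_sphere, mul_one]; exact ht.2
  -- the old-piece point is `ν (u, t • v)`
  have hval : (sphInSub ψ ε hε hεπ hψ (expT ((TubeTwist.const ε hε hεπ).shrink (t • (v : 𝔼 3)))) (angA u)
      : MTorus ψ) = (prodTube ψ ε hε hεπ hψ).toFun (u, t • (v : 𝔼 3)) := by
    rw [coe_sphInSub hx ha.1 (by linarith [ha.2]), prodTube_apply_of_ne ψ ε hε hεπ hψ hu,
      mtPt_of_mem_one _ ha]
    congr 2
    exact Subtype.ext (coe_angAPt hu).symm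
  rw [sphCap, sphIn, eq_comm, (prodTube ψ ε hε hεπ hψ).glueData.inl_eq_inr_iff,
    ← (prodTube ψ ε hε hεπ hψ).circleSurgeryRel_iff]
  refine ⟨u, t, ht, ?_, ?_⟩
  · rw [coe_sphCapSub hw]
  · rw [hval, coe_sphCapSub hw]

/-- The same relation with the base read in the second cylinder (`u` off `ptB`). [folklore] -/
theorem sphCap_smul_eq_sphIn_B {u : 𝕊 1} (hu : u ≠ ptB) {t : ℝ} (ht : t ∈ Ioo (0 : ℝ) 1) (v : 𝕊 2) :
    sphCap ψ ε hε hεπ hψ (t • (u : 𝔼 2)) v =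
      sphIn ψ ε hε hεπ hψ (expT ((TubeTwist.const ε hε hεπ).shrink (t • (v : 𝔼 3)))) (angB u) := by
  have htv : t • (v : 𝔼 3) ≠ 0 := smul_ne_zero ht.1.ne' (ne_zero_of_mem_unit_sphere v)
  have hx : expT ((TubeTwist.const ε hε hεπ).shrink (t • (v : 𝔼 3))) ≠ 1 := expT_shrink_ne_one hε hεπ htv
  have hb := angB_mem_Ioo hu
  have hw : ‖t • (u : 𝔼 2)‖ < 1 := by
    rw [norm_smul, Real.norm_eq_abs, abs_of_pos ht.1, norm_eq_of_mem_sphere, mul_one]; exact ht.2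
  have hval : (sphInSub ψ ε hε hεπ hψ (expT ((TubeTwist.const ε hε hεπ).shrink (t • (v : 𝔼 3)))) (angB u)
      : MTorus ψ) = (prodTube ψ ε hε hεπ hψ).toFun (u, t • (v : 𝔼 3)) := by
    rw [coe_sphInSub hx (by linarith [hb.1]) hb.2, prodTube_apply_of_ne_ptB ψ ε hε hεπ hψ hu,
      mtPt_of_mem_two _ ⟨hb.1, hb.2⟩]
    congr 2
    exact Subtype.ext (coe_angBPt hu).symm
  rw [sphCap, sphIn, eq_comm, (prodTube ψ ε hε hεπ hψ).glueData.inl_eq_inr_iff,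
    ← (prodTube ψ ε hε hεπ hψ).circleSurgeryRel_iff]
  refine ⟨u, t, ht, ?_, ?_⟩
  · rw [coe_sphCapSub hw]
  · rw [hval, coe_sphCapSub hw]

/-- **The two pieces are disjoint off the tube**: a point `sphIn x s` with `x = expT p`,
`ε/√2 ≤ ‖p‖`… — we record the useful form: `sphCap w v` (with `‖w‖ < 1`) equals some `sphIn x s`
only if `x = expT (shrink (‖w‖ • v'))`-type points; precisely, `sphCap w v ∈ range (inl)` iff
`w ≠ 0`. [folklore] -/
theorem sphCap_mem_range_inl_iff {w : 𝔼 2} (hw : ‖w‖ < 1) (v : 𝕊 2) :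
    sphCap ψ ε hε hεπ hψ w v ∈ range (prodTube ψ ε hε hεπ hψ).glueData.inl ↔ w ≠ 0 := by
  rw [sphCap, (prodTube ψ ε hε hεπ hψ).glueData.inr_mem_range_inl_iff]
  show sphCapSub w v ∈ (prodTube ψ ε hε hεπ hψ).glue.target ↔ w ≠ 0
  rw [CircleNbhd.glue_target]
  show (sphCapSub w v : (𝔼 2) × (𝕊 2)).1 ≠ 0 ↔ w ≠ 0
  rw [coe_sphCapSub hw]

end Sphere

/-! ### The vertical family and the cone -/

section Families

variable (ψ : ThreeTorus ≃ₘ⟮𝓣, 𝓣⟯ ThreeTorus) (ε : ℝ) (hε : 0 < ε) (hεπ : ε ≤ π)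
  (hψ : ∀ v : 𝔼 3, ‖v‖ < ε → ψ (expT v) = expT v)

/-- **The vertical family**: the point of the surgered sphere over the base point
`(n, s)` (first fibre coordinate `e^{in}`, base parameter `s`) with fibre offsets `(a, b)` in the
`(y, ℓ)`-directions about the section value `σ`: fibre `(e^{in}, e^{ia}, σ e^{ib})`. For fixed
base and `a² + b² = ϱ²` this is the normal circle of radius `ϱ` of the graph of the section — the
shell of a tubular neighbourhood of Gompf's surface `F′`. [cite: GompfAGT2010, Thm 2.1 (proof: F, F′) and Lemma 2.2] -/
def fishVert (n s : ℝ) (σ : Circle) (a b : ℝ) : prodSurgered ψ ε hε hεπ hψ :=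
  sphIn ψ ε hε hεπ hψ (Circle.exp n, Circle.exp a, σ * Circle.exp b) s

/-- The cone vector `(A, B cos β, B sin β)`. [folklore] -/
def fishConeVec (A B β : ℝ) : 𝔼 3 := vec3 A (B * Real.cos β) (B * Real.sin β)

/-- The norm of the cone vector is `√(A² + B²)`. [folklore] -/
theorem norm_coneVec (A B β : ℝ) : ‖fishConeVec A B β‖ = Real.sqrt (A ^ 2 + B ^ 2) := by
  rw [fishConeVec, norm_vec3]
  congr 1
  nlinarith [Real.sin_sq_add_cos_sq β]

/-- The normalised cone vector as a map `ℝ × ℝ → ℝ³` in `(B, β)` for fixed `A`. [folklore] -/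
def fishConeDirVec (A : ℝ) (p : ℝ × ℝ) : 𝔼 3 := (Real.sqrt (A ^ 2 + p.1 ^ 2))⁻¹ • fishConeVec A p.1 p.2

/-- The normalised cone vector is a unit vector (`A ≠ 0`). [folklore] -/
theorem coneDirVec_mem {A : ℝ} (hA : A ≠ 0) (p : ℝ × ℝ) : fishConeDirVec A p ∈ sphere (0 : 𝔼 3) 1 := by
  have h : 0 < A ^ 2 + p.1 ^ 2 := by positivity
  rw [mem_sphere_zero_iff_norm, fishConeDirVec, norm_smul, Real.norm_eq_abs, abs_inv,
    abs_of_nonneg (Real.sqrt_nonneg _), norm_coneVec, inv_mul_cancel₀ (Real.sqrt_ne_zero'.2 h)]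

/-- The normalised cone vector is smooth (`A ≠ 0`). [folklore] -/
theorem contDiff_coneDirVec {A : ℝ} (hA : A ≠ 0) : ContDiff ℝ ∞ (fishConeDirVec A) := by
  have h1 : ContDiff ℝ ∞ fun p : ℝ × ℝ ↦ (Real.sqrt (A ^ 2 + p.1 ^ 2))⁻¹ :=
    ((contDiff_const.add (contDiff_fst.pow 2)).sqrt fun p ↦ by positivity).inv fun p ↦
      Real.sqrt_ne_zero'.2 (by positivity)
  have h2 : ContDiff ℝ ∞ fun p : ℝ × ℝ ↦ fishConeVec A p.1 p.2 := by
    unfold fishConeVec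
    exact contDiff_vec3.comp (contDiff_const.prodMk ((contDiff_fst.mul (Real.contDiff_cos.comp contDiff_snd)).prodMk
      (contDiff_fst.mul (Real.contDiff_sin.comp contDiff_snd))))
  exact h1.smul h2

/-- **The cone direction** `(A, B cos β, B sin β)/√(A² + B²) ∈ 𝕊²` as a smooth map of `(B, β)`
(`A ≠ 0`; junk for `A = 0`). [folklore] -/
def fishConeDir (A B β : ℝ) : 𝕊 2 :=
  if h : A ≠ 0 then Set.codRestrict (fishConeDirVec A) _ (coneDirVec_mem h) (B, β) else sphBase

/-- The cone direction as a vector. [folklore] -/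
theorem coe_coneDir {A : ℝ} (hA : A ≠ 0) (B β : ℝ) :
    (fishConeDir A B β : 𝔼 3) = (Real.sqrt (A ^ 2 + B ^ 2))⁻¹ • fishConeVec A B β := by
  rw [fishConeDir, dif_pos hA]; rfl

/-- The cone direction is smooth in `(B, β)` (`A ≠ 0`). [folklore] -/
theorem contMDiff_coneDir {A : ℝ} (hA : A ≠ 0) :
    ContMDiff 𝓘(ℝ, ℝ × ℝ) (𝓡 2) ∞ fun p : ℝ × ℝ ↦ fishConeDir A p.1 p.2 := by
  have heq : (fun p : ℝ × ℝ ↦ fishConeDir A p.1 p.2) = Set.codRestrict (fishConeDirVec A) _ (coneDirVec_mem hA) := by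
    funext p; rw [fishConeDir, dif_pos hA]
  rw [heq]
  exact (contDiff_coneDirVec hA).contMDiff.codRestrict_sphere (coneDirVec_mem hA)

/-- **The cone**: the point `(w, fishConeDir A B β)` of the new piece. Over the cap of Gompf's disc
(a plane `D̊² × {v₀}` of the new piece) the normal circles are the circles of `𝕊²` about `v₀`;
`A = ∓cos ϱ′`, `B = λ sin ϱ′`. [cite: GompfAGT2010, Thm 2.1 (proof: surgery on C turns F′ into the disc D)] -/
def fishCone (w : 𝔼 2) (A B β : ℝ) : prodSurgered ψ ε hε hεπ hψ :=
  sphCap ψ ε hε hεπ hψ w (fishConeDir A B β)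

variable {ψ ε hε hεπ hψ}

/-- **The cone read off the core sphere is a vertical circle**: for `u ∈ 𝕊¹` off `ptA` and
`0 < t < 1`, `fishCone (t u) A B β = fishVert n (angA u) 1 a b` with
`(n, a, b) = c · (A, B cos β, B sin β)`, `c = ε t / (√(1 + t²) √(A² + B²))`. [folklore] -/
theorem conePt_smul_eq_vertPt {u : 𝕊 1} (hu : u ≠ ptA) {t : ℝ} (ht : t ∈ Ioo (0 : ℝ) 1) {A : ℝ}
    (hA : A ≠ 0) (B β : ℝ) :
    fishCone ψ ε hε hεπ hψ (t • (u : 𝔼 2)) A B β =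
      fishVert ψ ε hε hεπ hψ (ε * t / (Real.sqrt (1 + t ^ 2) * Real.sqrt (A ^ 2 + B ^ 2)) * A) (angA u) 1
        (ε * t / (Real.sqrt (1 + t ^ 2) * Real.sqrt (A ^ 2 + B ^ 2)) * (B * Real.cos β))
        (ε * t / (Real.sqrt (1 + t ^ 2) * Real.sqrt (A ^ 2 + B ^ 2)) * (B * Real.sin β)) := by
  rw [fishCone, sphCap_smul_eq_sphIn hu ht, fishVert, one_mul]
  congr 1
  have hn : ‖(t • (fishConeDir A B β : 𝔼 3))‖ = t := by
    rw [norm_smul, Real.norm_eq_abs, abs_of_pos ht.1, norm_eq_of_mem_sphere, mul_one]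
  rw [shrink_const_apply hε hεπ, hn, coe_coneDir hA, smul_smul, smul_smul, smul_smul, fishConeVec, smul_vec3,
    expT_vec3]
  have hc : ε * (Real.sqrt (1 + t ^ 2))⁻¹ * t * (Real.sqrt (A ^ 2 + B ^ 2))⁻¹ =
      ε * t / (Real.sqrt (1 + t ^ 2) * Real.sqrt (A ^ 2 + B ^ 2)) := by
    field_simp
  simp only [hc]

/-- The same overlap identity with the base read in the second cylinder (`u` off `ptB`). [folklore] -/
theorem conePt_smul_eq_vertPt_B {u : 𝕊 1} (hu : u ≠ ptB) {t : ℝ} (ht : t ∈ Ioo (0 : ℝ) 1) {A : ℝ}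
    (hA : A ≠ 0) (B β : ℝ) :
    fishCone ψ ε hε hεπ hψ (t • (u : 𝔼 2)) A B β =
      fishVert ψ ε hε hεπ hψ (ε * t / (Real.sqrt (1 + t ^ 2) * Real.sqrt (A ^ 2 + B ^ 2)) * A) (angB u) 1
        (ε * t / (Real.sqrt (1 + t ^ 2) * Real.sqrt (A ^ 2 + B ^ 2)) * (B * Real.cos β))
        (ε * t / (Real.sqrt (1 + t ^ 2) * Real.sqrt (A ^ 2 + B ^ 2)) * (B * Real.sin β)) := by
  rw [fishCone, sphCap_smul_eq_sphIn_B hu ht, fishVert, one_mul]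
  congr 1
  have hn : ‖(t • (fishConeDir A B β : 𝔼 3))‖ = t := by
    rw [norm_smul, Real.norm_eq_abs, abs_of_pos ht.1, norm_eq_of_mem_sphere, mul_one]
  rw [shrink_const_apply hε hεπ, hn, coe_coneDir hA, smul_smul, smul_smul, smul_smul, fishConeVec, smul_vec3,
    expT_vec3]
  have hc : ε * (Real.sqrt (1 + t ^ 2))⁻¹ * t * (Real.sqrt (A ^ 2 + B ^ 2))⁻¹ =
      ε * t / (Real.sqrt (1 + t ^ 2) * Real.sqrt (A ^ 2 + B ^ 2)) := by
    field_simp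
  simp only [hc]

section SmoothFam

variable {EQ HQ : Type*} [NormedAddCommGroup EQ] [NormedSpace ℝ EQ] [TopologicalSpace HQ]
  {IQ : ModelWithCorners ℝ EQ HQ} {Q : Type*} [TopologicalSpace Q] [ChartedSpace HQ Q]

/-- **Smoothness of the vertical family** in all its arguments: if `N, S, A, B : Q → ℝ` and
`Σ : Q → Circle` are smooth at `q`, `e^{iN q} ≠ 1` and `S q ∈ (0, 3/2)`, then
`q ↦ fishVert (N q) (S q) (Σ q) (A q) (B q)` is smooth at `q`. [folklore] -/
theorem contMDiffAt_vertPt_comp {N S A B : Q → ℝ} {Sg : Q → Circle} {q : Q}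
    (hN : ContMDiffAt IQ 𝓘(ℝ, ℝ) ∞ N q) (hS : ContMDiffAt IQ 𝓘(ℝ, ℝ) ∞ S q)
    (hSg : ContMDiffAt IQ (𝓡 1) ∞ Sg q) (hA : ContMDiffAt IQ 𝓘(ℝ, ℝ) ∞ A q)
    (hB : ContMDiffAt IQ 𝓘(ℝ, ℝ) ∞ B q) (hx : Circle.exp (N q) ≠ 1) (h0 : 0 < S q) (h1 : S q < 3 / 2) :
    ContMDiffAt IQ 𝓘(ℝ, 𝔼 4) ∞
      (fun q ↦ fishVert ψ ε hε hεπ hψ (N q) (S q) (Sg q) (A q) (B q)) q := by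
  unfold fishVert
  refine contMDiffAt_sphIn_comp ?_ hS ?_ h0 h1
  · exact (contMDiff_circleExp.contMDiffAt.comp q hN).prodMk
      ((contMDiff_circleExp.contMDiffAt.comp q hA).prodMk
        (hSg.mul (contMDiff_circleExp.contMDiffAt.comp q hB)))
  · intro h
    exact hx (congrArg Prod.fst h)

/-- **Smoothness of the cone** in `(w, B, β)` (`A ≠ 0`, `‖w‖ < 1`). [folklore] -/
theorem contMDiffAt_conePt_comp {A : ℝ} (hA : A ≠ 0) {W : Q → 𝔼 2} {Bf βf : Q → ℝ} {q : Q}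
    (hW : ContMDiffAt IQ 𝓘(ℝ, 𝔼 2) ∞ W q) (hB : ContMDiffAt IQ 𝓘(ℝ, ℝ) ∞ Bf q)
    (hβ : ContMDiffAt IQ 𝓘(ℝ, ℝ) ∞ βf q) (hw : ‖W q‖ < 1) :
    ContMDiffAt IQ 𝓘(ℝ, 𝔼 4) ∞ (fun q ↦ fishCone ψ ε hε hεπ hψ (W q) A (Bf q) (βf q)) q := by
  unfold fishCone
  refine contMDiffAt_sphCap_comp hW ?_ hw
  exact (contMDiff_coneDir hA).contMDiffAt.comp q (hB.prodMk_space hβ)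

end SmoothFam

/-- **Injectivity of the cone** in `(w, B, β)` for fixed `A ≠ 0`, `B > 0`: the sphere point
determines `B` (ratio of axial and transverse parts) and `β` modulo `2π`. We record the vector
identity used for this: the first coordinate of the direction is `A/√(A² + B²)` and the other two
are `B(cos β, sin β)/√(A² + B²)`. [folklore] -/
theorem coneDir_apply {A : ℝ} (hA : A ≠ 0) (B β : ℝ) :
    (fishConeDir A B β : 𝔼 3) 0 = A / Real.sqrt (A ^ 2 + B ^ 2) ∧
      (fishConeDir A B β : 𝔼 3) 1 = B * Real.cos β / Real.sqrt (A ^ 2 + B ^ 2) ∧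
      (fishConeDir A B β : 𝔼 3) 2 = B * Real.sin β / Real.sqrt (A ^ 2 + B ^ 2) := by
  rw [coe_coneDir hA]
  simp only [fishConeVec, PiLp.smul_apply, smul_eq_mul, vec3_apply_zero, vec3_apply_one, vec3_apply_two]
  refine ⟨by ring, by ring, by ring⟩

end Families

end Literature.Topology.FourManifolds
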